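import Mathlib
import HarnessLib
import Summits.Ventures.LatticeQCDFlow.Scoring.ReversibleVariationalVariance
import Summits.Ventures.LatticeQCDFlow.Scoring.DoeblinPowerGeometricEnvelope

/-!
# The BOUNDED-JUMP floor for reversible samplers on a general state space: a trial mode `g` moved by
# at most `A_g` per update gives `σ²_f ≥ 4⟨f̄, g⟩²_π/A_g² − ‖f̄‖²_π`; at `g = f`, `τ_int,f ≥ 2 Var_π f/A_f² − ½`

HONEST FRAMING: exact (Metropolis-corrected) sampling algorithms for lattice gauge theory;
figures of merit are autocorrelation/cost numbers at stated couplings and volumes; no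
continuum-physics claim.

Venture `LatticeQCDFlow` (cell pub-lqcd), topic `Scoring`; FANOUT row 8 (`s0-cpn-nemc`, GEN-23).
NEW WORK of the cell, not a published result; no definition is introduced; nothing is cited as a
fact.  `Scoring/ReversibleVariationalVariance` proved, for a `π`-reversible kernel with the geometric
sup-norm envelope and a bounded observable `f` (`f̄ = f − πf`,
`σ²_f = ∫ f̄² dπ + 2 Σ' k, ∫ f̄ (kop κ)^[k+1] f̄ dπ`), the slow-mode transfer bound
`σ²_f ≥ 2⟨f̄, g⟩² / 𝓔(g) − ‖f̄‖²` with the Dirichlet form `𝓔(g) = ∫ g (g − kop κ g) dπ = ½ E_π[(g(X₁) −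
g(X₀))²]`.  THIS FILE bounds the Dirichlet form by the size of the moves: if a single update changes
`g` by at most `A_g` (`|g(y) − g(x)| ≤ A_g` for `κ(x, ·)`-a.e. `y`, every `x` — a local or
small-step algorithm seen through the mode `g`), then `𝓔(g) ≤ A_g²/2` (invariance only), hence for a
reversible kernel **`σ²_f ≥ 4⟨f̄, g⟩²/A_g² − ‖f̄‖²`** for every bounded observable `f` (the case
`𝓔(g) = 0` is handled: then `⟨f̄, g⟩ = 0` by the variational bound at every multiple of `g`), and at
`g = f`: **`σ²_f ≥ 4 (Var_π f)²/A_f² − Var_π f`, i.e. `τ_int,f = σ²_f/(2 Var_π f) ≥ 2 Var_π f/A_f² − ½`**.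
Reading for the venture (value-free): a reversible exact sampler whose single update changes the
topological charge by at most `A` almost surely has `τ_int(Q) ≥ 2 Var_π(Q)/A² − ½` in units of that
update, whatever its proposal mechanism (local heat bath, HMC trajectory, flow proposal), and every
observable correlated with `Q` inherits a floor through its squared overlap — a typed no-go direction of
the kind the venture's theory pair lists (volume scaling: `Var_π(Q)` grows with the volume at fixed
`A`).  Printed counterparts NAMED ONLY: Caracciolo–Pelissetto–Sokal 1990; Madras–Slade, *The
Self-Avoiding Walk*, Cor. 9.2.3 with eq. (9.2.28) (finite state space) — nothing is cited as a fact.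

## Content (`π` invariant; envelope `(A, ρ)`, `0 ≤ ρ < 1`; `κ` `π`-reversible where stated;
## `|f| ≤ C`, `|g| ≤ C_g` measurable)

* **`kopDirichlet_le_of_jump_le`** — jumps `≤ A_g` a.s. `⇒ ∫ g (g − kop κ g) dπ ≤ A_g²/2` (invariance only);
* `kopDirichlet_le_half_integral_of_meanSqJump_le` — a state-dependent budget `∫(g−g x)² dκ(x,·) ≤ b x`
  gives `∫ g (g − kop κ g) dπ ≤ ½ ∫ b dπ` (e.g. `b = A² ·` move probability: low acceptance tightens floors);
* `meanSqJump_le_sq_mul_moveProb` — jumps `≤ A_g` a.s. `⇒ ∫ (g y − g x)² dκ(x,·) ≤ A_g² · κ(x, {x}ᶜ)`;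
* `chain_meanSqJump_eq_two_kopDirichlet` — along the stationary chain `E_π[(g(X₁) − g(X₀))²] = 2 ∫ g (g − kop κ g) dπ`;
* **`greenKubo_ge_overlap_sq_div_jump_sq_of_isReversible`** — `A_g > 0 ⇒ σ²_f ≥ 4 (∫ f̄ g dπ)²/A_g² − ∫ f̄² dπ`;
  `greenKubo_ge_overlap_sq_div_jumpBudget_of_isReversible` — the same with `∫ b dπ > 0` in place of `A_g²`;
  **`greenKubo_ge_overlap_sq_div_jump_sq_mul_moveBound_of_isReversible`** — the ACCEPTANCE-RATE floor
  `σ²_f ≥ 4 (∫ f̄ g dπ)²/(A_g² ᾱ) − ∫ f̄² dπ`, `ᾱ = ∫ α dπ` for any measurable bound `κ(x,{x}ᶜ) ≤ α x`;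
  `greenKubo_ge_boundedJump_self_of_nHit_of_isReversible` — the self floor with a Doeblin-power
  certificate in place of the envelope;
* **`greenKubo_ge_boundedJump_self_of_isReversible`** — `σ²_f ≥ 4 (∫ f̄² dπ)²/A_f² − ∫ f̄² dπ`.

NOT CLAIMED: non-reversible kernels; unbounded observables; any `A_g` of a concrete sampler (the
engines' per-update change of `Q` is a number of theirs, not typed here); any number of ours.
-/

noncomputable section

namespace Summit.Ventures.LatticeQCDFlow.Scoring

open MeasureTheory ProbabilityTheory Filter Finset Preorder Literature.Probability.MarkovChains
open scoped ENNReal Topology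

variable {Ω : Type*} [MeasurableSpace Ω]

/-! ### Bounded jumps bound the Dirichlet form -/

section Dirichlet

variable (κ : Kernel Ω Ω) [IsMarkovKernel κ] {π : Measure Ω} [IsProbabilityMeasure π]

/-- **Bounded jumps bound the Dirichlet form**: if `|g y − g x| ≤ A_g` for `κ(x, ·)`-a.e. `y`, every
`x`, then `∫ g (g − kop κ g) dπ ≤ A_g²/2` (`π` invariant). -/
theorem kopDirichlet_le_of_jump_le (hπ : Kernel.Invariant κ π) {g : Ω → ℝ} (hg : Measurable g)
    {Cg : ℝ} (hCg : ∀ x, |g x| ≤ Cg) {Ag : ℝ} (hjump : ∀ x, ∀ᵐ y ∂(κ x), |g y - g x| ≤ Ag) :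
    ∫ x, g x * (g x - kop κ g x) ∂π ≤ Ag ^ 2 / 2 := by
  rw [kopDirichlet_eq_half_meanSqJump κ hπ hg hCg]
  have hin : ∀ x, ∫ y, (g y - g x) ^ 2 ∂(κ x) ≤ Ag ^ 2 := fun x => by
    calc ∫ y, (g y - g x) ^ 2 ∂(κ x) ≤ ∫ _y, Ag ^ 2 ∂(κ x) := by
          refine integral_mono_of_nonneg (ae_of_all _ fun y => sq_nonneg _) (integrable_const _)
            ((hjump x).mono fun y hy => ?_)
          calc (g y - g x) ^ 2 = |g y - g x| ^ 2 := (sq_abs _).symm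
            _ ≤ Ag ^ 2 := pow_le_pow_left₀ (abs_nonneg _) hy 2
      _ = Ag ^ 2 := by rw [integral_const, probReal_univ, one_smul]
  have hout : ∫ x, (∫ y, (g y - g x) ^ 2 ∂(κ x)) ∂π ≤ Ag ^ 2 := by
    calc ∫ x, (∫ y, (g y - g x) ^ 2 ∂(κ x)) ∂π ≤ ∫ _x, Ag ^ 2 ∂π :=
          integral_mono_of_nonneg (ae_of_all _ fun x => integral_nonneg fun y => sq_nonneg _)
            (integrable_const _) (ae_of_all _ hin)
      _ = Ag ^ 2 := by rw [integral_const, probReal_univ, one_smul]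
  linarith

/-- **State-dependent jump budget**: if the mean squared jump from `x` is at most `b x`
(`∫ (g y − g x)² dκ(x,·) ≤ b x`, `b` bounded measurable — e.g. `b x = A² · (move probability at x)` for a
Metropolis-type update whose proposals move `g` by at most `A`), then `∫ g (g − kop κ g) dπ ≤ ½ ∫ b dπ`
(`π` invariant): a low acceptance rate tightens the bounded-jump floors by its mean. -/
theorem kopDirichlet_le_half_integral_of_meanSqJump_le (hπ : Kernel.Invariant κ π) {g : Ω → ℝ}
    (hg : Measurable g) {Cg : ℝ} (hCg : ∀ x, |g x| ≤ Cg) {b : Ω → ℝ} (hbm : Measurable b) {Cb : ℝ}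
    (hCb : ∀ x, |b x| ≤ Cb) (hjump : ∀ x, ∫ y, (g y - g x) ^ 2 ∂(κ x) ≤ b x) :
    ∫ x, g x * (g x - kop κ g x) ∂π ≤ (1 / 2) * ∫ x, b x ∂π := by
  rw [kopDirichlet_eq_half_meanSqJump κ hπ hg hCg]
  refine mul_le_mul_of_nonneg_left ?_ (by norm_num)
  exact integral_mono_of_nonneg (ae_of_all _ fun x => integral_nonneg fun y => sq_nonneg _)
    (integrable_of_bounded π hbm hCb) (ae_of_all _ hjump)

/-- **Jumps `≤ A` and a holding probability**: on a space with measurable singletons, if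
`|g y − g x| ≤ A_g` for `κ(x,·)`-a.e. `y` then the mean squared jump from `x` is at most
`A_g² · κ(x, {x}ᶜ)` — `A_g²` times the MOVE probability (the integrand vanishes on `{x}`). -/
theorem meanSqJump_le_sq_mul_moveProb [MeasurableSingletonClass Ω] {g : Ω → ℝ} (hg : Measurable g)
    {Cg : ℝ} (hCg : ∀ x, |g x| ≤ Cg) {Ag : ℝ} (hjump : ∀ x, ∀ᵐ y ∂(κ x), |g y - g x| ≤ Ag) (x : Ω) :
    ∫ y, (g y - g x) ^ 2 ∂(κ x) ≤ Ag ^ 2 * ((κ x) {x}ᶜ).toReal := by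
  have hS : MeasurableSet ({x}ᶜ : Set Ω) := (measurableSet_singleton x).compl
  have hvan : ∫ y, (g y - g x) ^ 2 ∂(κ x) = ∫ y in {x}ᶜ, (g y - g x) ^ 2 ∂(κ x) := by
    rw [← integral_indicator hS]
    refine integral_congr_ae (ae_of_all _ fun y => ?_)
    by_cases hy : y = x
    · subst hy; simp
    · rw [Set.indicator_of_mem (by simpa using hy)]
  rw [hvan]
  have hφb : ∀ y, |(g y - g x) ^ 2| ≤ (Cg + Cg) ^ 2 := fun y => by
    rw [abs_pow]
    exact pow_le_pow_left₀ (abs_nonneg _) ((abs_sub _ _).trans (add_le_add (hCg y) (hCg x))) 2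
  calc ∫ y in {x}ᶜ, (g y - g x) ^ 2 ∂(κ x) ≤ ∫ _y in {x}ᶜ, Ag ^ 2 ∂(κ x) := by
        refine setIntegral_mono_ae ((integrable_of_bounded (κ x) ((hg.sub_const _).pow_const 2)
          hφb).integrableOn) (integrableOn_const) ?_
        exact (hjump x).mono fun y hy => by
          calc (g y - g x) ^ 2 = |g y - g x| ^ 2 := (sq_abs _).symm
            _ ≤ Ag ^ 2 := pow_le_pow_left₀ (abs_nonneg _) hy 2
    _ = Ag ^ 2 * ((κ x) {x}ᶜ).toReal := by
        rw [setIntegral_const, smul_eq_mul, mul_comm]; rfl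

/-- **The Dirichlet form along the stationary chain**: `E_π[(g(X₁) − g(X₀))²] = 2 ∫ g (g − kop κ g) dπ`
(`π` invariant, `g` bounded measurable) — the mean squared one-step jump of `g` along the run IS twice
the Dirichlet form, so `⟨g, g − kop κ g⟩_π` is a plain chain average. -/
theorem chain_meanSqJump_eq_two_kopDirichlet (hπ : Kernel.Invariant κ π) {g : Ω → ℝ}
    (hg : Measurable g) {Cg : ℝ} (hCg : ∀ x, |g x| ≤ Cg) :
    ∫ x, (g (x 1) - g (x 0)) ^ 2 ∂(Kernel.trajMeasure (X := fun _ : ℕ => Ω) π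
        (fun n : ℕ => κ.comap (fun h : (i : ↥(Finset.Iic n)) → Ω => h ⟨n, Finset.mem_Iic.2 le_rfl⟩)
          (measurable_pi_apply _)))
      = 2 * ∫ x, g x * (g x - kop κ g x) ∂π := by
  set P := Kernel.trajMeasure (X := fun _ : ℕ => Ω) π
      (fun n : ℕ => κ.comap (fun h : (i : ↥(Finset.Iic n)) → Ω => h ⟨n, Finset.mem_Iic.2 le_rfl⟩)
        (measurable_pi_apply _)) with hP
  have hCg0 : 0 ≤ Cg := (abs_nonneg _).trans (hCg (Classical.choice (nonempty_of_isProbabilityMeasure π)))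
  have hg2 : Measurable fun y => g y ^ 2 := hg.pow_const 2
  have hCg2 : ∀ y, |g y ^ 2| ≤ Cg ^ 2 := fun y => by
    rw [abs_pow]; exact pow_le_pow_left₀ (abs_nonneg _) (hCg y) 2
  have e0 : ∫ x, g (x 0) ^ 2 ∂P = ∫ y, g y ^ 2 ∂π := chain_marginal hπ 0 hg2 hCg2
  have e1 : ∫ x, g (x 1) ^ 2 ∂P = ∫ y, g y ^ 2 ∂π := chain_marginal hπ 1 hg2 hCg2
  have e01 : ∫ x, g (x 0) * g (x (0 + 1)) ∂P = ∫ y, g y * (kop κ)^[1] g y ∂π :=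
    chain_twoTime_eq_integral hπ hg hCg hg hCg 0 1
  simp only [Nat.zero_add, Function.iterate_one] at e01
  have hi0 : Integrable (fun x : ℕ → Ω => g (x 0) ^ 2) P :=
    integrable_of_bounded P ((hg.comp (measurable_pi_apply _)).pow_const 2) fun x => hCg2 _
  have hi1 : Integrable (fun x : ℕ → Ω => g (x 1) ^ 2) P :=
    integrable_of_bounded P ((hg.comp (measurable_pi_apply _)).pow_const 2) fun x => hCg2 _
  have hi01 : Integrable (fun x : ℕ → Ω => g (x 0) * g (x 1)) P :=
    integrable_of_bounded P ((hg.comp (measurable_pi_apply _)).mul (hg.comp (measurable_pi_apply _)))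
      (C := Cg * Cg) fun x => by
      rw [abs_mul]; exact mul_le_mul (hCg _) (hCg _) (abs_nonneg _) hCg0
  have hexp : (fun x : ℕ → Ω => (g (x 1) - g (x 0)) ^ 2)
      = fun x => (g (x 1) ^ 2 + g (x 0) ^ 2) - 2 * (g (x 0) * g (x 1)) := by
    funext x; ring
  have hi10 : Integrable (fun x : ℕ → Ω => g (x 1) ^ 2 + g (x 0) ^ 2) P := hi1.add hi0
  have hi2 : Integrable (fun x : ℕ → Ω => 2 * (g (x 0) * g (x 1))) P := hi01.const_mul 2
  rw [hexp, integral_sub hi10 hi2, integral_add hi1 hi0, integral_const_mul, e0, e1, e01]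
  -- right-hand side: `2 (∫ g² − ∫ g Kg)`
  have hig2 : Integrable (fun y => g y ^ 2) π := integrable_of_bounded π hg2 hCg2
  have higK : Integrable (fun y => g y * kop κ g y) π :=
    integrable_of_bounded π (hg.mul (measurable_kop κ hg)) (C := Cg * Cg) fun y => by
      rw [abs_mul]; exact mul_le_mul (hCg y) (abs_kop_le κ hCg y) (abs_nonneg _) hCg0
  have e : (fun y => g y * (g y - kop κ g y)) = fun y => g y ^ 2 - g y * kop κ g y := by
    funext y; ring
  rw [e, integral_sub hig2 higK]
  ring

end Dirichlet

/-! ### The floors -/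

section Reversible

variable {κ : Kernel Ω Ω} [IsMarkovKernel κ] {π : Measure Ω} [IsProbabilityMeasure π] {A ρ : ℝ}

/-- **THE BOUNDED-JUMP (slow local mode) FLOOR.**  `κ` `π`-reversible with the envelope, `|f| ≤ C`
measurable; `g` bounded measurable whose single-step jumps are at most `A_g > 0`
(`|g y − g x| ≤ A_g` for `κ(x,·)`-a.e. `y`, every `x`): `σ²_f ≥ 4 (∫ f̄ g dπ)²/A_g² − ∫ f̄² dπ`. -/
theorem greenKubo_ge_overlap_sq_div_jump_sq_of_isReversible (hrev : Kernel.IsReversible κ π)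
    (henv : ∀ (g : Ω → ℝ), Measurable g → ∀ (Cg : ℝ), (∀ x, |g x| ≤ Cg) →
      ∀ (t : ℕ) (x : Ω), |(kop κ)^[t] g x - ∫ y, g y ∂π| ≤ 2 * Cg * (A * ρ ^ t))
    (hρ0 : 0 ≤ ρ) (hρ1 : ρ < 1)
    {f : Ω → ℝ} (hf : Measurable f) {C : ℝ} (hC : ∀ x, |f x| ≤ C)
    {g : Ω → ℝ} (hg : Measurable g) {Cg : ℝ} (hCg : ∀ x, |g x| ≤ Cg)
    {Ag : ℝ} (hAg : 0 < Ag) (hjump : ∀ x, ∀ᵐ y ∂(κ x), |g y - g x| ≤ Ag) :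
    4 * (∫ y, (f y - ∫ z, f z ∂π) * g y ∂π) ^ 2 / Ag ^ 2 - ∫ y, (f y - ∫ z, f z ∂π) ^ 2 ∂π
      ≤ (∫ y, (f y - ∫ z, f z ∂π) ^ 2 ∂π)
        + 2 * ∑' k, ∫ y, (f y - ∫ z, f z ∂π) * (kop κ)^[k + 1] (fun y => f y - ∫ z, f z ∂π) y ∂π := by
  have hπ : Kernel.Invariant κ π := hrev.invariant
  set a := ∫ y, (f y - ∫ z, f z ∂π) * g y ∂π with ha
  set E := ∫ y, g y * (g y - kop κ g y) ∂π with hEdef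
  have hE0 : 0 ≤ E := kopDirichlet_nonneg κ hπ hg hCg
  have hEA : E ≤ Ag ^ 2 / 2 := kopDirichlet_le_of_jump_le κ hπ hg hCg hjump
  rcases hE0.eq_or_lt with hEz | hEpos
  · -- `𝓔(g) = 0`: the variational bound with `c · g` for every `c` forces `a = 0`
    have hcg : ∀ c : ℝ, 4 * (c * a) - ∫ y, (f y - ∫ z, f z ∂π) ^ 2 ∂π
        ≤ (∫ y, (f y - ∫ z, f z ∂π) ^ 2 ∂π)
          + 2 * ∑' k, ∫ y, (f y - ∫ z, f z ∂π) * (kop κ)^[k + 1] (fun y => f y - ∫ z, f z ∂π) y ∂π := by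
      intro c
      have hcgm : Measurable fun y => c * g y := hg.const_mul c
      have hCcg : ∀ x, |c * g x| ≤ |c| * Cg := fun x => by
        rw [abs_mul]; exact mul_le_mul_of_nonneg_left (hCg x) (abs_nonneg _)
      have hvar := greenKubo_ge_variational_of_isReversible hrev henv hρ0 hρ1 hf hC hcgm hCcg
      have hKc : ∀ y, kop κ (fun z => c * g z) y = c * kop κ g y := fun y => by
        unfold kop; exact integral_const_mul c _
      have e1 : ∫ y, (f y - ∫ z, f z ∂π) * (c * g y) ∂π = c * a := by
        rw [ha, ← integral_const_mul]
        exact integral_congr_ae (ae_of_all _ fun y => by ring)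
      have e2 : ∫ y, (c * g y) * ((c * g y) - kop κ (fun z => c * g z) y) ∂π = c ^ 2 * E := by
        rw [hEdef, ← integral_const_mul]
        exact integral_congr_ae (ae_of_all _ fun y => by
      simp only [hKc y]; ring)
      rw [e1, e2, ← hEz, mul_zero, mul_zero, sub_zero] at hvar
      exact hvar
    set σ2 := (∫ y, (f y - ∫ z, f z ∂π) ^ 2 ∂π)
      + 2 * ∑' k, ∫ y, (f y - ∫ z, f z ∂π) * (kop κ)^[k + 1] (fun y => f y - ∫ z, f z ∂π) y ∂π
    set v := ∫ y, (f y - ∫ z, f z ∂π) ^ 2 ∂π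
    have haz : a = 0 := by
      by_contra hne
      -- take `c = (σ2 + v + 1)/(4a)`: then `4 c a − v = σ2 + 1 > σ2`
      have h := hcg ((σ2 + v + 1) / (4 * a))
      have e : 4 * ((σ2 + v + 1) / (4 * a) * a) = σ2 + v + 1 := by field_simp
      rw [e] at h
      linarith
    rw [haz]
    have h0 := greenKubo_nonneg_of_envelope hπ henv hρ0 hρ1 hf hC
    have hv : 0 ≤ v := integral_nonneg fun y => sq_nonneg _
    simp only [ne_eq, OfNat.ofNat_ne_zero, not_false_eq_true, zero_pow, mul_zero, zero_div, zero_sub]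
    linarith
  · have hmain := greenKubo_ge_overlap_sq_div_dirichlet_of_isReversible hrev henv hρ0 hρ1 hf hC hg
      hCg hEpos
    -- `2a²/E ≥ 2a²/(A²/2) = 4a²/A²`
    have hcmp : 4 * a ^ 2 / Ag ^ 2 ≤ 2 * a ^ 2 / E := by
      rw [div_le_div_iff₀ (by positivity) hEpos]
      nlinarith [sq_nonneg a, hEA]
    linarith

/-- **THE SLOW-MODE FLOOR WITH A STATE-DEPENDENT JUMP BUDGET**: `κ` `π`-reversible with the envelope,
`|f| ≤ C` measurable, `g` bounded measurable with `∫ (g y − g x)² dκ(x,·) ≤ b x` (`b` bounded measurable,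
`∫ b dπ > 0`): `σ²_f ≥ 4 (∫ f̄ g dπ)² / ∫ b dπ − ∫ f̄² dπ`. -/
theorem greenKubo_ge_overlap_sq_div_jumpBudget_of_isReversible (hrev : Kernel.IsReversible κ π)
    (henv : ∀ (g : Ω → ℝ), Measurable g → ∀ (Cg : ℝ), (∀ x, |g x| ≤ Cg) →
      ∀ (t : ℕ) (x : Ω), |(kop κ)^[t] g x - ∫ y, g y ∂π| ≤ 2 * Cg * (A * ρ ^ t))
    (hρ0 : 0 ≤ ρ) (hρ1 : ρ < 1)
    {f : Ω → ℝ} (hf : Measurable f) {C : ℝ} (hC : ∀ x, |f x| ≤ C)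
    {g : Ω → ℝ} (hg : Measurable g) {Cg : ℝ} (hCg : ∀ x, |g x| ≤ Cg)
    {b : Ω → ℝ} (hbm : Measurable b) {Cb : ℝ} (hCb : ∀ x, |b x| ≤ Cb)
    (hjump : ∀ x, ∫ y, (g y - g x) ^ 2 ∂(κ x) ≤ b x) (hb : 0 < ∫ x, b x ∂π) :
    4 * (∫ y, (f y - ∫ z, f z ∂π) * g y ∂π) ^ 2 / ∫ x, b x ∂π - ∫ y, (f y - ∫ z, f z ∂π) ^ 2 ∂π
      ≤ (∫ y, (f y - ∫ z, f z ∂π) ^ 2 ∂π)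
        + 2 * ∑' k, ∫ y, (f y - ∫ z, f z ∂π) * (kop κ)^[k + 1] (fun y => f y - ∫ z, f z ∂π) y ∂π := by
  have hπ : Kernel.Invariant κ π := hrev.invariant
  set a := ∫ y, (f y - ∫ z, f z ∂π) * g y ∂π with ha
  set E := ∫ y, g y * (g y - kop κ g y) ∂π with hEdef
  have hE0 : 0 ≤ E := kopDirichlet_nonneg κ hπ hg hCg
  have hEb : E ≤ (1 / 2) * ∫ x, b x ∂π :=
    kopDirichlet_le_half_integral_of_meanSqJump_le κ hπ hg hCg hbm hCb hjump
  rcases hE0.eq_or_lt with hEz | hEpos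
  · -- `𝓔(g) = 0`: as in the bounded-jump floor, the variational bound at every multiple forces `a = 0`
    have hcg : ∀ c : ℝ, 4 * (c * a) - ∫ y, (f y - ∫ z, f z ∂π) ^ 2 ∂π
        ≤ (∫ y, (f y - ∫ z, f z ∂π) ^ 2 ∂π)
          + 2 * ∑' k, ∫ y, (f y - ∫ z, f z ∂π) * (kop κ)^[k + 1] (fun y => f y - ∫ z, f z ∂π) y ∂π := by
      intro c
      have hcgm : Measurable fun y => c * g y := hg.const_mul c
      have hCcg : ∀ x, |c * g x| ≤ |c| * Cg := fun x => by
        rw [abs_mul]; exact mul_le_mul_of_nonneg_left (hCg x) (abs_nonneg _)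
      have hvar := greenKubo_ge_variational_of_isReversible hrev henv hρ0 hρ1 hf hC hcgm hCcg
      have hKc : ∀ y, kop κ (fun z => c * g z) y = c * kop κ g y := fun y => by
        unfold kop; exact integral_const_mul c _
      have e1 : ∫ y, (f y - ∫ z, f z ∂π) * (c * g y) ∂π = c * a := by
        rw [ha, ← integral_const_mul]
        exact integral_congr_ae (ae_of_all _ fun y => by ring)
      have e2 : ∫ y, (c * g y) * ((c * g y) - kop κ (fun z => c * g z) y) ∂π = c ^ 2 * E := by
        rw [hEdef, ← integral_const_mul]
        exact integral_congr_ae (ae_of_all _ fun y => by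
          simp only [hKc y]; ring)
      rw [e1, e2, ← hEz, mul_zero, mul_zero, sub_zero] at hvar
      exact hvar
    set σ2 := (∫ y, (f y - ∫ z, f z ∂π) ^ 2 ∂π)
      + 2 * ∑' k, ∫ y, (f y - ∫ z, f z ∂π) * (kop κ)^[k + 1] (fun y => f y - ∫ z, f z ∂π) y ∂π
    set v := ∫ y, (f y - ∫ z, f z ∂π) ^ 2 ∂π
    have haz : a = 0 := by
      by_contra hne
      have h := hcg ((σ2 + v + 1) / (4 * a))
      have e : 4 * ((σ2 + v + 1) / (4 * a) * a) = σ2 + v + 1 := by field_simp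
      rw [e] at h
      linarith
    rw [haz]
    have h0 := greenKubo_nonneg_of_envelope hπ henv hρ0 hρ1 hf hC
    have hv : 0 ≤ v := integral_nonneg fun y => sq_nonneg _
    simp only [ne_eq, OfNat.ofNat_ne_zero, not_false_eq_true, zero_pow, mul_zero, zero_div, zero_sub]
    linarith
  · have hmain := greenKubo_ge_overlap_sq_div_dirichlet_of_isReversible hrev henv hρ0 hρ1 hf hC hg
      hCg hEpos
    have hcmp : 4 * a ^ 2 / ∫ x, b x ∂π ≤ 2 * a ^ 2 / E := by
      rw [div_le_div_iff₀ hb hEpos]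
      nlinarith [sq_nonneg a, hEb]
    linarith

/-- **THE ACCEPTANCE-RATE FLOOR**: `κ` `π`-reversible with the envelope on a space with measurable
singletons, `|f| ≤ C` measurable, `g` bounded measurable with jumps `≤ A_g` (`κ(x,·)`-a.e., every `x`),
and a bounded measurable bound `α` on the MOVE probability, `κ(x, {x}ᶜ) ≤ α x` (e.g. a Metropolis
acceptance function), with `∫ α dπ > 0`: `σ²_f ≥ 4 (∫ f̄ g dπ)²/(A_g² ∫ α dπ) − ∫ f̄² dπ`; at `g = f`:
`τ_int,f ≥ 2 Var_π f/(A_f² ᾱ) − ½` with `ᾱ = ∫ α dπ` — a low mean acceptance slows every observable. -/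
theorem greenKubo_ge_overlap_sq_div_jump_sq_mul_moveBound_of_isReversible [MeasurableSingletonClass Ω]
    (hrev : Kernel.IsReversible κ π)
    (henv : ∀ (g : Ω → ℝ), Measurable g → ∀ (Cg : ℝ), (∀ x, |g x| ≤ Cg) →
      ∀ (t : ℕ) (x : Ω), |(kop κ)^[t] g x - ∫ y, g y ∂π| ≤ 2 * Cg * (A * ρ ^ t))
    (hρ0 : 0 ≤ ρ) (hρ1 : ρ < 1)
    {f : Ω → ℝ} (hf : Measurable f) {C : ℝ} (hC : ∀ x, |f x| ≤ C)
    {g : Ω → ℝ} (hg : Measurable g) {Cg : ℝ} (hCg : ∀ x, |g x| ≤ Cg)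
    {Ag : ℝ} (hjump : ∀ x, ∀ᵐ y ∂(κ x), |g y - g x| ≤ Ag)
    {α : Ω → ℝ} (hαm : Measurable α) {Cα : ℝ} (hCα : ∀ x, |α x| ≤ Cα)
    (hα : ∀ x, ((κ x) {x}ᶜ).toReal ≤ α x) (hacc : 0 < ∫ x, α x ∂π) :
    4 * (∫ y, (f y - ∫ z, f z ∂π) * g y ∂π) ^ 2 / (Ag ^ 2 * ∫ x, α x ∂π)
        - ∫ y, (f y - ∫ z, f z ∂π) ^ 2 ∂π
      ≤ (∫ y, (f y - ∫ z, f z ∂π) ^ 2 ∂π)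
        + 2 * ∑' k, ∫ y, (f y - ∫ z, f z ∂π) * (kop κ)^[k + 1] (fun y => f y - ∫ z, f z ∂π) y ∂π := by
  -- budget `b x = A_g² α x`
  have hbm : Measurable fun x => Ag ^ 2 * α x := hαm.const_mul _
  have hCb : ∀ x, |Ag ^ 2 * α x| ≤ Ag ^ 2 * Cα := fun x => by
    rw [abs_mul, abs_of_nonneg (sq_nonneg _)]
    exact mul_le_mul_of_nonneg_left (hCα x) (sq_nonneg _)
  have hjb : ∀ x, ∫ y, (g y - g x) ^ 2 ∂(κ x) ≤ Ag ^ 2 * α x := fun x =>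
    (meanSqJump_le_sq_mul_moveProb κ hg hCg hjump x).trans
      (mul_le_mul_of_nonneg_left (hα x) (sq_nonneg _))
  rcases (sq_nonneg Ag).eq_or_lt with hA0 | hApos
  · -- `A_g = 0`: the left side is `0/0 − v = −v ≤ σ²`
    rw [← hA0, zero_mul, div_zero, zero_sub]
    have h0 := greenKubo_nonneg_of_envelope hrev.invariant henv hρ0 hρ1 hf hC
    have hv : 0 ≤ ∫ y, (f y - ∫ z, f z ∂π) ^ 2 ∂π := integral_nonneg fun y => sq_nonneg _
    linarith
  · have hb : 0 < ∫ x, Ag ^ 2 * α x ∂π := by rw [integral_const_mul]; exact mul_pos hApos hacc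
    have h := greenKubo_ge_overlap_sq_div_jumpBudget_of_isReversible hrev henv hρ0 hρ1 hf hC hg hCg hbm
      hCb hjb hb
    rw [integral_const_mul] at h
    exact h

/-- **THE BOUNDED-JUMP FLOOR FOR THE OBSERVABLE ITSELF** (Madras–Slade Cor. 9.2.3 / Caracciolo–
Pelissetto–Sokal on a general state space): `κ` `π`-reversible with the envelope, `|f| ≤ C` measurable,
single-step jumps of `f` at most `A_f > 0` (`|f y − f x| ≤ A_f` for `κ(x,·)`-a.e. `y`, every `x`):
`σ²_f ≥ 4 (∫ f̄² dπ)²/A_f² − ∫ f̄² dπ`, i.e. `τ_int,f = σ²_f/(2 Var_π f) ≥ 2 Var_π f/A_f² − ½`. -/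
theorem greenKubo_ge_boundedJump_self_of_isReversible (hrev : Kernel.IsReversible κ π)
    (henv : ∀ (g : Ω → ℝ), Measurable g → ∀ (Cg : ℝ), (∀ x, |g x| ≤ Cg) →
      ∀ (t : ℕ) (x : Ω), |(kop κ)^[t] g x - ∫ y, g y ∂π| ≤ 2 * Cg * (A * ρ ^ t))
    (hρ0 : 0 ≤ ρ) (hρ1 : ρ < 1)
    {f : Ω → ℝ} (hf : Measurable f) {C : ℝ} (hC : ∀ x, |f x| ≤ C)
    {Af : ℝ} (hAf : 0 < Af) (hjump : ∀ x, ∀ᵐ y ∂(κ x), |f y - f x| ≤ Af) :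
    4 * (∫ y, (f y - ∫ z, f z ∂π) ^ 2 ∂π) ^ 2 / Af ^ 2 - ∫ y, (f y - ∫ z, f z ∂π) ^ 2 ∂π
      ≤ (∫ y, (f y - ∫ z, f z ∂π) ^ 2 ∂π)
        + 2 * ∑' k, ∫ y, (f y - ∫ z, f z ∂π) * (kop κ)^[k + 1] (fun y => f y - ∫ z, f z ∂π) y ∂π := by
  obtain ⟨hfb, hCfb, -⟩ := centred_observable_bounds π hf hC
  have hjump' : ∀ x, ∀ᵐ y ∂(κ x), |(f y - ∫ z, f z ∂π) - (f x - ∫ z, f z ∂π)| ≤ Af := fun x =>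
    (hjump x).mono fun y hy => by
      have e : (f y - ∫ z, f z ∂π) - (f x - ∫ z, f z ∂π) = f y - f x := by ring
      rw [e]; exact hy
  have h := greenKubo_ge_overlap_sq_div_jump_sq_of_isReversible hrev henv hρ0 hρ1 hf hC hfb hCfb hAf
    hjump'
  have e : ∫ y, (f y - ∫ z, f z ∂π) * (f y - ∫ z, f z ∂π) ∂π = ∫ y, (f y - ∫ z, f z ∂π) ^ 2 ∂π :=
    integral_congr_ae (ae_of_all _ fun y => by ring)
  rw [e] at h
  exact h

/-- **THE BOUNDED-JUMP FLOOR IN CERTIFICATE FORM**: `κ` `π`-reversible with an `m`-step Doeblin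
certificate `(nHit κ m)(x, ·) ≥ ε ν` (`0 < ε ≤ 1`, `0 < m`), `|f| ≤ C` measurable, single-step jumps of `f`
at most `A_f > 0`: `σ²_f ≥ 4 (Var_π f)²/A_f² − Var_π f` (`τ_int,f ≥ 2 Var_π f/A_f² − ½`). -/
theorem greenKubo_ge_boundedJump_self_of_nHit_of_isReversible (hrev : Kernel.IsReversible κ π)
    {m : ℕ} {ε : ℝ≥0∞} {ν : Measure Ω} [IsProbabilityMeasure ν]
    (hmin : ∀ x {B : Set Ω}, MeasurableSet B → ε * ν B ≤ Exactness.nHit κ m x B)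
    (hε0 : 0 < ε) (hε1 : ε ≤ 1) (hm : 0 < m)
    {f : Ω → ℝ} (hf : Measurable f) {C : ℝ} (hC : ∀ x, |f x| ≤ C)
    {Af : ℝ} (hAf : 0 < Af) (hjump : ∀ x, ∀ᵐ y ∂(κ x), |f y - f x| ≤ Af) :
    4 * (∫ y, (f y - ∫ z, f z ∂π) ^ 2 ∂π) ^ 2 / Af ^ 2 - ∫ y, (f y - ∫ z, f z ∂π) ^ 2 ∂π
      ≤ (∫ y, (f y - ∫ z, f z ∂π) ^ 2 ∂π)
        + 2 * ∑' k, ∫ y, (f y - ∫ z, f z ∂π) * (kop κ)^[k + 1] (fun y => f y - ∫ z, f z ∂π) y ∂π := by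
  obtain ⟨A', ρ', -, hρ0, hρ1, henv⟩ :=
    exists_geometricEnvelope_of_nHit hmin hε0 hε1 hm hrev.invariant
  exact greenKubo_ge_boundedJump_self_of_isReversible hrev henv hρ0 hρ1 hf hC hAf hjump

end Reversible

end Summit.Ventures.LatticeQCDFlow.Scoring

end
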